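import Summits.QuantumAdvantage.QuantumAdvantage.Theses.LinnikCubicClassGroups

/-!
# Line `arakelov-giant-step-cycle` — skeleton for the crux `LinnikCubicClassGroups.PureCubicClassGroupFBQP`
(crux item stmt-QuantumAdvantage-11544, rank 3, route `route-QuantumAdvantage-LinnikCubicClassGroups`)

Crux (FIXED, by name): `DegreeOnePrimesEscape → ∃ f ∈ FBQP, |f x| = 2|x|+8 ∧ ∀ K cubic ∋ ∛m (m = decodeNat x
non-cube), f x = the 2|x|+8 low bits of h(K)`.

Idea (crux idea card `arakelov-giant-step-cycle`, ideator 3; triage r1-1/2/3: pass, "front half of LINE P"): the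
cycle of reduced Arakelov divisors / Voronoi relative minima of the COMPLEX cubic order (unit rank ONE) is an
infrastructure in the sense of the tree's `GiantStepCycle` (baby step = Voronoi step, giant step = multiply +
reduce with bounded distance defect, Buchmann–Williams 1988), except that the real-quadratic double-gap axiom
`two_gap` must be replaced by a SIX-gap: at most 6 relative minima have their real conjugate in one dyadic range
(`stub_packing`, the card's `CubicMinimaPacking` sharpened 12 → 6 by triage r1-2), so `P(m+6) − P(m) ≥ log 2`.
Hence the regulator `R = log σ₁(ε)` of `ℚ(∛m)` (the circumference of the cycle, `stub_regulatorPeriod`) is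
computable in quantum polynomial time with NO Riemann hypothesis (`stub_regulator`, = the shared first lemma
`CubicRegulatorQSolvable` of cards regulator-first-exact-modes / arakelov-giant-step-cycle). The back half of
LINE P (cards one-blurred-coordinate + regulator-first-exact-modes) is `stub_subgroupOrder`: with a regulator
solver in hand, ONE Fourier-sampling family over `ℤ_M^T × ℤ_q` on the cycles of `∏ 𝔭ᵢ^{eᵢ}` plus exact-mode
post-processing outputs the order of the subgroup of `Cl(K)` generated by the degree-one primes above given
rational primes. Generation is the route's hypothesis: `stub_generation` turns `DegreeOnePrimesEscape` (+ the
route's support item RandomSamplesGenerate, + Dedekind–Kummer, + PNT) into "T random rational primes ≤ X suffice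
w.p. ≥ 7/8, and good primes have density ≥ 1/(4 log₂ X + 4)". `stub_assembly` is the randomised classical wrap
(coins → primes → one quantum call → truncate to 2|x|+8 bits) landing in the CANONICAL relation `Rcanon`
(= the graph of the cdisprove `canonicalF`); the composition `PureCubicClassGroupFBQP_of` (sorry-free) turns
`IsQSolvable Rcanon` into the crux: the relation is nonempty on every input (success 2/3 > 0), a choice of its
value gives `f`, and the `∀ K` clause inside the relation yields both the value clause and the well-definedness
of `h(K)` across admissible `K` (two prefixes of equal length of one string coincide) — no separate
`classNumber_eq_of_cubic` is needed.

THE LINE (7 registered stubs after the lead's reshape of 2026-08-16: S4 split into S4a `stub_cubicFieldFacts` + S4b `stub_generation`, S6 takes S4a, composed by `PureCubicClassGroupFBQP_of`):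
* `stub_packing` (S1, M, provable now) — ≤ 6 relative minima per dyadic real range (60° argument).
* `stub_regulatorPeriod` (S2, M, provable now) — least unit `ε` with `σ₁ ε > 1`; `log σ₁ ε = regulator K`.
* `stub_regulator` (S3, XL, printed: Hallgren 2005 / Schmidt–Vollmer 2005 unit group in constant degree, GRH-free;
  here via the cubic `GiantStepCycle` with 6-gap) — S1 → S2 → `CubicRegulatorQSolvable`. LOAD-BEARING for this card.
* `stub_generation` (S4, M) — `DegreeOnePrimesEscape` → density + generation counts. The ONLY place the crux's
  hypothesis enters (Disproof `not_crux_iff`: any proof must use it; it is used exactly for generation, h ≥ 2).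
* `stub_subgroupOrder` (S5, XL, HARDEST) — regulator solver → 15/16-solver for the subgroup order (r = 1 HSP).
* `stub_assembly` (S6, L, plumbing) — S4-conclusion → S5-conclusion → `IsQSolvable Rcanon`.

Guards honoured (Disproof v1–v2.1 evidence notes): every relation uses `x` only through `m = decodeNat x` and `|x|`;
the non-cube / cube-root / degree-3 clauses are carried verbatim; for cube `m` no `K` is admissible and `Rcanon`
forces the all-zero word. Vocabulary: all existing declarations (`IsQSolvable`, `FBQP`, `QCircuitFamily.kernelProb`,
`boolPair`, `encodingListNatBool`, `encodeNat`/`decodeNat`, `NumberField.Units.regulator`, `NumberField.classNumber`,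
`ClassGroup.mk0`, `Ideal.absNorm`, `DegreeOnePrimesEscape`); definition-free (nothing here is importable).
-/

set_option linter.unusedVariables false
set_option linter.dupNamespace false

namespace Summit.QuantumAdvantage.QuantumAdvantage.Cruxes.PureCubicClassGroupFBQP.ArakelovGiantStepCycle

open Computability (encodeNat decodeNat)
open Literature.Computability.Cryptography (IsQSolvable FBQP QCircuitFamily cliffordT)
open Literature.Computability.Complexity (boolPair encodingListNatBool)
open scoped NumberField
open Summit.QuantumAdvantage.QuantumAdvantage.Theses.LinnikCubicClassGroups
  (DegreeOnePrimesEscape PureCubicClassGroupFBQP)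

/-! ## S1 — packing of relative minima (the card's `CubicMinimaPacking`, sharpened) -/

/-- **S1 `stub_packing`** (provable now, size M; triage r1-2 proof). For ANY field `K` with a real embedding `σ₁`
and a complex embedding `σ₂`, any additive subgroup `L ⊆ K` and any `t > 0`: at most SIX elements `θ ∈ L` are
relative minima of `L` (no nonzero `φ ∈ L` has both `|σ₁ φ| < |σ₁ θ|` and `‖σ₂ φ‖ < ‖σ₂ θ‖`) with real conjugate in
the dyadic range `t ≤ σ₁ θ < 2t`. Proof: for two such minima `θᵢ ≠ θⱼ`, `φ = θⱼ − θᵢ ∈ L ∖ 0` has `|σ₁ φ| < t`, so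
minimality of BOTH gives `‖σ₂θⱼ − σ₂θᵢ‖ ≥ max (‖σ₂θᵢ‖, ‖σ₂θⱼ‖)`, i.e. the angle at `0` between `σ₂θᵢ, σ₂θⱼ ≠ 0` is
`≥ 60°`; seven nonzero points of `ℂ` contain two in one half-open `60°` sector. Consequence used by S3: along the
Voronoi chain of a reduced ideal of a complex cubic field, `δ_{k+6} − δ_k ≥ log 2` (the SIX-gap replacing
`GiantStepCycle.two_gap`, triage r1-2/r1-3 sharpen). (`encard ≤ 6` also records finiteness.) -/
theorem stub_packing : ∀ (K : Type) [Field K] (σ₁ : K →+* ℝ) (σ₂ : K →+* ℂ) (L : AddSubgroup K) (t : ℝ),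
    0 < t → Set.encard {θ : K | θ ∈ L ∧ θ ≠ 0 ∧
      (∀ φ ∈ L, φ ≠ 0 → |σ₁ φ| < |σ₁ θ| → ‖σ₂ θ‖ ≤ ‖σ₂ φ‖) ∧ t ≤ σ₁ θ ∧ σ₁ θ < 2 * t} ≤ 6 := by
  sorry

/-! ## S2 — the circumference of the cycle is the regulator -/

/-- **S2 `stub_regulatorPeriod`** (provable now, size M; Dirichlet for signature (1,1), Mathlib
`NumberField.Units.regulator`). A cubic number field `K` with a real embedding `σ₁` and a NON-REAL embedding `σ₂`
has unit rank one: there is a unit `ε` of `𝓞 K` with `σ₁ ε > 1` which is LEAST with this property, and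
`log σ₁(ε)` is Mathlib's regulator of `K` (the `1 × 1` log-embedding determinant at either remaining place:
`|log|σ₁ε||` at the real place, `|2 log|σ₂ε|| = |log|σ₁ε||` at the complex one, since `σ₁(ε)|σ₂(ε)|² = ±1`).
This is the period of the distance function `log|σ₁ ·|` along the cycle of reduced divisors (Buchmann–Williams 1988;
Schoof 2008 Prop. 6.5 at `r = 1`). -/
theorem stub_regulatorPeriod : ∀ (K : Type) [Field K] [NumberField K], Module.finrank ℚ K = 3 →
    ∀ (σ₁ : K →+* ℝ) (σ₂ : K →+* ℂ), (∃ z : K, starRingEnd ℂ (σ₂ z) ≠ σ₂ z) →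
    ∃ ε : (𝓞 K)ˣ, 1 < σ₁ ((ε : 𝓞 K) : K) ∧
      Real.log (σ₁ ((ε : 𝓞 K) : K)) = NumberField.Units.regulator K ∧
      ∀ u : (𝓞 K)ˣ, 1 < σ₁ ((u : 𝓞 K) : K) → σ₁ ((ε : 𝓞 K) : K) ≤ σ₁ ((u : 𝓞 K) : K) := by
  sorry

/-! ## S3 — the regulator of `ℚ(∛m)` in quantum polynomial time, no GRH (LOAD-BEARING for this card) -/

/-- **S3 `stub_regulator`** (size XL; printed for constant degree: Hallgren 2005 Thm. (unit group) /
Schmidt–Vollmer 2005, both GRH-free; the real-quadratic twin is the tree's PROVED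
`Hallgren2007_regulator_qsolvable_delim_holds`). From S1 (six-gap) and S2 (period = regulator): the search
problem "on input `⟨x, 1^k⟩` with `m = decodeNat x` not a cube, output `⟨bin r, ·⟩` with `|r − 2^k R_K| ≤ 1`"
is `IsQSolvable`, `R_K` the regulator of any cubic `K ∋ ∛m` (all `≅ ℚ(∛m)`). Plan (the card): Shor-factor
`m = f³ab²` and write Dedekind's basis of `𝓞_K` (`factoring_mem_FBQP_holds`, Cohen 1993 §6.4); the Voronoi chain
of `𝓞_K` with tracked distances `log σ₁` is a `GiantStepCycle`-type instance (rho = Voronoi step, star =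
product + reduction, `|kappa| ≤ K = O(log |D_K|)`, gaps `≤ G = O(log|D_K|)`, SIX-gap `≥ log 2` by S1, evaluators
to `2^{-p(|x|,k)}`); then the tree's pipeline `InfrastructureNavigation` (generalised from `two_gap` to a 6-gap:
the only uses are `two_babySteps_ge` / `iterate_babyStep_ge`) → `HallgrenBlurredTable` → `HallgrenCombCorrMass`
→ `PeriodFindingTwoSamples` → `HallgrenCandidateCheck` → `isQSolvable_classicalWrap_holds`, exactly as in
`HallgrenPellQuantum.lean`, with `k` extra grid bits. Statement = card regulator-first-exact-modes' first lemma
verbatim (triage: one decl for `CubicRegulatorQSolvable ≡ PureCubicRegulatorQSolvable`). -/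
theorem stub_regulator :
    (∀ (K : Type) [Field K] (σ₁ : K →+* ℝ) (σ₂ : K →+* ℂ) (L : AddSubgroup K) (t : ℝ),
      0 < t → Set.encard {θ : K | θ ∈ L ∧ θ ≠ 0 ∧
        (∀ φ ∈ L, φ ≠ 0 → |σ₁ φ| < |σ₁ θ| → ‖σ₂ θ‖ ≤ ‖σ₂ φ‖) ∧ t ≤ σ₁ θ ∧ σ₁ θ < 2 * t} ≤ 6) →
    (∀ (K : Type) [Field K] [NumberField K], Module.finrank ℚ K = 3 →
      ∀ (σ₁ : K →+* ℝ) (σ₂ : K →+* ℂ), (∃ z : K, starRingEnd ℂ (σ₂ z) ≠ σ₂ z) →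
      ∃ ε : (𝓞 K)ˣ, 1 < σ₁ ((ε : 𝓞 K) : K) ∧
        Real.log (σ₁ ((ε : 𝓞 K) : K)) = NumberField.Units.regulator K ∧
        ∀ u : (𝓞 K)ˣ, 1 < σ₁ ((u : 𝓞 K) : K) → σ₁ ((ε : 𝓞 K) : K) ≤ σ₁ ((u : 𝓞 K) : K)) →
    IsQSolvable fun w => {y | ∀ (x : List Bool) (k : ℕ), w = boolPair x (List.replicate k true) →
      ∀ (K : Type) [Field K] [NumberField K], Module.finrank ℚ K = 3 →
        (∀ r : ℕ, r ^ 3 ≠ decodeNat x) → (∃ α : K, α ^ 3 = (decodeNat x : K)) →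
        ∃ (r : ℕ) (t : List Bool), y = boolPair (encodeNat r) t ∧
          |(r : ℝ) - 2 ^ k * NumberField.Units.regulator K| ≤ 1} := by
  sorry

/-! ## S4a — elementary arithmetic of pure cubic fields (reshaped in by the lead, 2026-08-16) -/

/-- **S4a `stub_cubicFieldFacts`** (provable now, size M–L; ELEMENTARY — no analytic input). For a
non-cube `m`: (0) an admissible field EXISTS (`ℚ[X]/(X³ − m)`, irreducible by the rational root theorem /
Kummer, a number field of degree 3 with a cube root of `m`); and for every cubic number field `K ∋ α`, `α³ = m`:
(1) `K` has NO quadratic subfield (tower law: `finrank F ∣ 3`); (2) `|d_K| ≤ 27 m²` (`α` is integral, generates `K`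
since `m` is not a cube, `disc(1, α, α²) = disc(X³ − m) = −27 m² = [𝓞_K : ℤ[α]]² · d_K`, Mathlib
`Algebra.discr_of_matrix_vecMul` + `discr_powerBasis_eq_norm`); (3) `h_K ≤ (27 m²)^10` (Minkowski
`exists_ideal_in_class_of_norm_le`: every class has an integral ideal of norm `≤ (4/π)(6/27)√|d_K| < 2m`; ideals of
norm `n` inject into additive subgroups of `𝓞_K/(n) ≅ (ℤ/n)³`, each generated by `≤ 3` elements, so `≤ n⁹` of
them; crude but POLYNOMIAL, which is what S4b's union bound needs); (4) at most `3` prime ideals of `𝓞_K` have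
norm `p` (`Σ e f = 3`, Mathlib `Ideal.sum_ramification_inertia`). Shared by S4b (generation) and S6 (existence of
an admissible `K`, for the vacuity of the zero clause). -/
theorem stub_cubicFieldFacts : ∀ m : ℕ, (∀ r : ℕ, r ^ 3 ≠ m) →
      (∃ (K : Type) (_ : Field K) (_ : NumberField K), Module.finrank ℚ K = 3 ∧ ∃ α : K, α ^ 3 = (m : K)) ∧
      ∀ (K : Type) [Field K] [NumberField K], Module.finrank ℚ K = 3 → (∃ α : K, α ^ 3 = (m : K)) →
        (∀ F : IntermediateField ℚ K, Module.finrank ℚ F ≠ 2) ∧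
        |NumberField.discr K| ≤ 27 * (m : ℤ) ^ 2 ∧
        NumberField.classNumber K ≤ (27 * m ^ 2) ^ 10 ∧
        ∀ p : ℕ, p.Prime → {P : Ideal (𝓞 K) | P.IsPrime ∧ Ideal.absNorm P = p}.ncard ≤ 3 := by
  sorry

/-! ## S4b — generation: random rational primes whose degree-one primes generate the class group -/

/-- **S4b `stub_generation`** (size M given S4a; the route's hypothesis enters HERE and only here). From S4a and
`DegreeOnePrimesEscape` (at `n = 3`: a cubic field has no quadratic subfield) plus the route's support item
`RandomSamplesGenerate` (stmt-QuantumAdvantage-11545: union bound over coatoms, `#Sub(G) ≤ |G|^{log₂|G|+1}`),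
Dedekind–Kummer (`|d_K| ≤ 27 m²` for `K ∋ ∛m`; at most 3 degree-one primes above `p`) and the prime number theorem
(tree: `primeCounting_bounds`; `C` absorbs its threshold): there is `C` such that for every cubic `K ∋ ∛m`
(`m` non-cube) and `X ≥ (27 m²)^C` — (i) DENSITY: the good primes `p ≤ X, p ∤ 3m` number `≥ X / (4 (log₂ X + 1))`
(unconditional; this is what the sampler of S6 needs, also when `h = 1`); (ii) GENERATION: for
`T ≥ 600 (log₂ X + 1)²`, all but a fraction `≤ 1/8` of the `T`-tuples of good primes have the property that the
classes of ALL degree-one primes (`Ideal.absNorm P = p`) above them generate `Cl(𝓞 K)` (for `h = 1` trivially; for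
`h ≥ 2` each maximal subgroup is escaped by the degree-one primes above `≥ π(X)/24 − O(log m)` good primes). -/
theorem stub_generation :
    (∀ m : ℕ, (∀ r : ℕ, r ^ 3 ≠ m) →
      (∃ (K : Type) (_ : Field K) (_ : NumberField K), Module.finrank ℚ K = 3 ∧ ∃ α : K, α ^ 3 = (m : K)) ∧
      ∀ (K : Type) [Field K] [NumberField K], Module.finrank ℚ K = 3 → (∃ α : K, α ^ 3 = (m : K)) →
        (∀ F : IntermediateField ℚ K, Module.finrank ℚ F ≠ 2) ∧
        |NumberField.discr K| ≤ 27 * (m : ℤ) ^ 2 ∧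
        NumberField.classNumber K ≤ (27 * m ^ 2) ^ 10 ∧
        ∀ p : ℕ, p.Prime → {P : Ideal (𝓞 K) | P.IsPrime ∧ Ideal.absNorm P = p}.ncard ≤ 3) →
    DegreeOnePrimesEscape → ∃ C : ℕ, ∀ (K : Type) [Field K] [NumberField K],
    Module.finrank ℚ K = 3 → ∀ m : ℕ, (∀ r : ℕ, r ^ 3 ≠ m) → (∃ α : K, α ^ 3 = (m : K)) →
    ∀ X : ℕ, (27 * m ^ 2) ^ C ≤ X →
      X ≤ 4 * (Nat.log 2 X + 1) * Nat.card {p : ℕ // p.Prime ∧ p ≤ X ∧ ¬ p ∣ 3 * m} ∧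
      ∀ T : ℕ, 600 * (Nat.log 2 X + 1) ^ 2 ≤ T →
        8 * Nat.card {v : Fin T → {p : ℕ // p.Prime ∧ p ≤ X ∧ ¬ p ∣ 3 * m} //
            Subgroup.closure {c : ClassGroup (𝓞 K) | ∃ i : Fin T, ∃ P : Ideal (𝓞 K),
              ∃ hP : P ∈ nonZeroDivisors (Ideal (𝓞 K)),
                P.IsPrime ∧ Ideal.absNorm P = (v i : ℕ) ∧ c = ClassGroup.mk0 ⟨P, hP⟩} ≠ ⊤} ≤
          Nat.card {p : ℕ // p.Prime ∧ p ≤ X ∧ ¬ p ∣ 3 * m} ^ T := by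
  sorry

/-! ## S5 — the quantum core: order of the subgroup generated by given degree-one primes (HARDEST) -/

/-- **S5 `stub_subgroupOrder`** (size XL, HARDEST; the crux's why-might-fail lives here). Given ANY quantum
regulator solver (the conclusion of S3, to be run in a parallel block — no sequential composition of quantum
stages is needed: the class-group sampling oracle does not depend on `R`, only its post-processing does), there is a
poly-time uniform oracle-free Clifford+T family which, on input `⟨x, ⟨f, a, b⟩, [p₁,…,p_T]⟩` with
`m = decodeNat x = f³ab²` non-cube, `ab` squarefree (the squarefree decomposition is PART OF THE INPUT, so that this
stub is "all classical data → one Fourier-sampling stage → classical post-processing", the shape of the tree's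
`isQSolvable_classicalWrap`; Shor lives in S6) and every `pᵢ` prime, `pᵢ ∤ 3m`, outputs with probability `≥ 15/16`
(amplified inside, so that S6 needs no majority vote) `⟨bin h', ·⟩` where `h'` is the ORDER OF THE SUBGROUP of
`Cl(𝓞 K)` generated by the classes of all degree-one primes (`absNorm P = pᵢ`) above the `pᵢ`, for any cubic
`K ∋ ∛m`. In print: Hallgren 2005 (class group structure from generators, constant degree; GRH is used there only to
PRODUCE generators) — here `r = 1`: Dedekind's basis of `𝓞_K` from `(a, b)` (Cohen 1993 §6.4); Dedekind–Kummer for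
the `≤ 3` primes above each `pᵢ` (`pᵢ ∤ 3m ⇒ pᵢ ∤ [𝓞_K : ℤ[∛m]]`);
Fourier sampling of `(e, j) ↦ Enc(reduced divisor nearest below distance j/N on the cycle of ∏ 𝔭ᵢ^{eᵢ})` over
`ℤ_M^T × ℤ_q` (exactly Λ-equivariant in `e`, pseudo-periodic in the one distance coordinate: card
one-blurred-coordinate's `CoherentCombsMass`, generalising the tree's `norm_fibreSum_ge`); with `R` known the
`j`-frequency of each sample is an EXACT integer mode, integer kernel combinations give exact characters of
`Λ*/ℤ^T`, continued fractions + the tree's Howell engine `Hallgren2005.SubgroupOrder.subgroupOrder_eq_card_closure`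
give `h' = [ℤ^T : Λ]` (card regulator-first-exact-modes; rejection of far samples per triage r1-3 sharpen). -/
theorem stub_subgroupOrder :
    (IsQSolvable fun w => {y | ∀ (x : List Bool) (k : ℕ), w = boolPair x (List.replicate k true) →
      ∀ (K : Type) [Field K] [NumberField K], Module.finrank ℚ K = 3 →
        (∀ r : ℕ, r ^ 3 ≠ decodeNat x) → (∃ α : K, α ^ 3 = (decodeNat x : K)) →
        ∃ (r : ℕ) (t : List Bool), y = boolPair (encodeNat r) t ∧
          |(r : ℝ) - 2 ^ k * NumberField.Units.regulator K| ≤ 1}) →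
    ∃ F : QCircuitFamily cliffordT, F.IsOracleFree ∧ F.IsUniform ∧ ∀ w : List Bool,
      (15 : ℝ) / 16 ≤ F.kernelProb 0 w {y | ∀ (x : List Bool) (f a b : ℕ) (ps : List ℕ),
        w = boolPair x (boolPair (boolPair (encodeNat f) (boolPair (encodeNat a) (encodeNat b)))
          (encodingListNatBool.encode ps)) →
        decodeNat x = f ^ 3 * (a * b ^ 2) → Squarefree (a * b) →
        ∀ (K : Type) [Field K] [NumberField K], Module.finrank ℚ K = 3 →
          (∀ r : ℕ, r ^ 3 ≠ decodeNat x) → (∃ α : K, α ^ 3 = (decodeNat x : K)) →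
          (∀ p ∈ ps, p.Prime ∧ ¬ p ∣ 3 * decodeNat x) →
          ∃ t : List Bool, y = boolPair (encodeNat (Nat.card (Subgroup.closure
            {c : ClassGroup (𝓞 K) | ∃ p ∈ ps, ∃ P : Ideal (𝓞 K), ∃ hP : P ∈ nonZeroDivisors (Ideal (𝓞 K)),
              P.IsPrime ∧ Ideal.absNorm P = p ∧ c = ClassGroup.mk0 ⟨P, hP⟩}))) t} := by
  sorry

/-! ## S6 — assembly: randomised classical wrap into the canonical relation (plumbing) -/

/-- **S6 `stub_assembly`** (size L, plumbing in the tree's circuit model; no number theory beyond deciding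
cubes). From the counts of S4 (with ITS constant `C`) and the family of S5: the canonical search problem
`Rcanon` — "output a `2|x|+8`-bit word `v` as a prefix, `v` = low bits of `h(K)` for every admissible `K`, and
`v = 0…0` when no `K` is admissible (i.e. `m` a cube)" — is `IsQSolvable`. Algorithm: if `m = decodeNat x` is a
cube (integer cube root, classical) write zeros; else factor `m` completely with the tree's `FACT ∈ BQP`
(`FACT_mem_BQP_of_wrap_base` + the two `_holds`; classical `FP^FACT` search as in `ShorAssembly`) and read off
`m = f³ab²`, `ab` squarefree; `X := (27 m²)^C`, `T := 600 (log₂ X + 1)²`; draw `64 · T · (log₂ X + 1)` uniform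
integers `≤ X` from coins, keep the first `T` that are prime (the tree's `AKSMachine` / `PRIMES ∈ P`) and `∤ 3m`
(shortage probability `≤ 1/16` by S4 (i)); if short, output the bits of `1` (CORRECT whenever `h = 1`; when `h ≥ 2`
this branch has probability `≤ 1/16`); else ONE call to S5's family on `⟨x, ⟨f,a,b⟩, ps⟩` (success `≥ 15/16`,
generation failure `≤ 1/8` by S4 (ii)), unpair, and emit the `2|x|+8` low bits of `h'` (`testBit`). Total error
`≤ 1/16 + 1/8 + 1/16 + (FACT-oracle slack) < 1/3`. Model work (the one new brick of the line, size L): "coins +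
pre-processing in `FP^A` with `A ∈ BQP` + ONE call to a search-solving family + post-processing in `FP` ⇒
`IsQSolvable`" — the common generalisation of the tree's PROVED `isQSolvable_of_mem_FPRel_BQP_holds` (coins, BQP
oracle, no search call) and `isQSolvable_classicalWrap_holds` (one search call, deterministic `FP` pre-processing),
by deferred measurement exactly as in `CWrap` files I–VII. For the vacuity of the zero-clause on non-cubes the prover
exhibits `ℚ(∛m)` (`AdjoinRoot (X³ − m)`, irreducible by the rational root theorem) as an admissible `K`. -/
theorem stub_assembly :
    (∀ m : ℕ, (∀ r : ℕ, r ^ 3 ≠ m) →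
      (∃ (K : Type) (_ : Field K) (_ : NumberField K), Module.finrank ℚ K = 3 ∧ ∃ α : K, α ^ 3 = (m : K)) ∧
      ∀ (K : Type) [Field K] [NumberField K], Module.finrank ℚ K = 3 → (∃ α : K, α ^ 3 = (m : K)) →
        (∀ F : IntermediateField ℚ K, Module.finrank ℚ F ≠ 2) ∧
        |NumberField.discr K| ≤ 27 * (m : ℤ) ^ 2 ∧
        NumberField.classNumber K ≤ (27 * m ^ 2) ^ 10 ∧
        ∀ p : ℕ, p.Prime → {P : Ideal (𝓞 K) | P.IsPrime ∧ Ideal.absNorm P = p}.ncard ≤ 3) →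
    (∃ C : ℕ, ∀ (K : Type) [Field K] [NumberField K],
      Module.finrank ℚ K = 3 → ∀ m : ℕ, (∀ r : ℕ, r ^ 3 ≠ m) → (∃ α : K, α ^ 3 = (m : K)) →
      ∀ X : ℕ, (27 * m ^ 2) ^ C ≤ X →
        X ≤ 4 * (Nat.log 2 X + 1) * Nat.card {p : ℕ // p.Prime ∧ p ≤ X ∧ ¬ p ∣ 3 * m} ∧
        ∀ T : ℕ, 600 * (Nat.log 2 X + 1) ^ 2 ≤ T →
          8 * Nat.card {v : Fin T → {p : ℕ // p.Prime ∧ p ≤ X ∧ ¬ p ∣ 3 * m} //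
              Subgroup.closure {c : ClassGroup (𝓞 K) | ∃ i : Fin T, ∃ P : Ideal (𝓞 K),
                ∃ hP : P ∈ nonZeroDivisors (Ideal (𝓞 K)),
                  P.IsPrime ∧ Ideal.absNorm P = (v i : ℕ) ∧ c = ClassGroup.mk0 ⟨P, hP⟩} ≠ ⊤} ≤
            Nat.card {p : ℕ // p.Prime ∧ p ≤ X ∧ ¬ p ∣ 3 * m} ^ T) →
    (∃ F : QCircuitFamily cliffordT, F.IsOracleFree ∧ F.IsUniform ∧ ∀ w : List Bool,
      (15 : ℝ) / 16 ≤ F.kernelProb 0 w {y | ∀ (x : List Bool) (f a b : ℕ) (ps : List ℕ),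
        w = boolPair x (boolPair (boolPair (encodeNat f) (boolPair (encodeNat a) (encodeNat b)))
          (encodingListNatBool.encode ps)) →
        decodeNat x = f ^ 3 * (a * b ^ 2) → Squarefree (a * b) →
        ∀ (K : Type) [Field K] [NumberField K], Module.finrank ℚ K = 3 →
          (∀ r : ℕ, r ^ 3 ≠ decodeNat x) → (∃ α : K, α ^ 3 = (decodeNat x : K)) →
          (∀ p ∈ ps, p.Prime ∧ ¬ p ∣ 3 * decodeNat x) →
          ∃ t : List Bool, y = boolPair (encodeNat (Nat.card (Subgroup.closure
            {c : ClassGroup (𝓞 K) | ∃ p ∈ ps, ∃ P : Ideal (𝓞 K), ∃ hP : P ∈ nonZeroDivisors (Ideal (𝓞 K)),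
              P.IsPrime ∧ Ideal.absNorm P = p ∧ c = ClassGroup.mk0 ⟨P, hP⟩}))) t}) →
    IsQSolvable fun x => {y | ∃ v : List Bool, v.length = 2 * x.length + 8 ∧ v <+: y ∧
      (∀ (K : Type) [Field K] [NumberField K], Module.finrank ℚ K = 3 →
        (∀ r : ℕ, r ^ 3 ≠ decodeNat x) → (∃ α : K, α ^ 3 = (decodeNat x : K)) →
        v = List.ofFn (fun i : Fin (2 * x.length + 8) => (NumberField.classNumber K).testBit i.val)) ∧
      ((¬ ∃ (K : Type) (_ : Field K) (_ : NumberField K), Module.finrank ℚ K = 3 ∧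
          (∀ r : ℕ, r ^ 3 ≠ decodeNat x) ∧ ∃ α : K, α ^ 3 = (decodeNat x : K)) →
        v = List.replicate (2 * x.length + 8) false)} := by
  sorry

/-! ## Composition (sorry-free): the canonical relation gives the crux -/

/-- Search solvability is monotone in the relation (inlined copy of the tree's `IsQSolvable.mono`,
`ShorProofs.lean`, to keep this file's imports to the route file alone). [folklore] -/
theorem isQSolvable_mono {R S : List Bool → Set (List Bool)}
    (h : IsQSolvable R) (hRS : ∀ x, R x ⊆ S x) : IsQSolvable S := by
  obtain ⟨F, hF, hU, hR⟩ := h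
  refine ⟨F, hF, hU, fun x => le_trans (hR x) ?_⟩
  refine ENNReal.toReal_mono (ne_top_of_le_ne_top ENNReal.one_ne_top ?_)
    ((F.kernel 0 x).toOuterMeasure_mono ((Set.inter_subset_left).trans (hRS x)))
  rw [← ((F.kernel 0 x).toOuterMeasure_apply_eq_one_iff Set.univ).2 (Set.subset_univ _)]
  exact (F.kernel 0 x).toOuterMeasure_mono (Set.inter_subset_left.trans (Set.subset_univ _))

/-- **From the canonical search problem to the crux's conclusion.** If `Rcanon` is `IsQSolvable` then the
crux's `∃ f ∈ FBQP …` holds: (1) success probability `2/3 > 0` makes `Rcanon x` NONEMPTY for every `x`; (2) choose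
a member and let `f x` be its `2|x|+8`-bit word `v`; (3) the word is the SAME for every member of `Rcanon x` — by
the `∀ K` clause when an admissible `K` exists (this is where well-definedness of `h` across admissible `K` drops
out: two admissible fields both pin `v`), by the zero clause otherwise — so `Rcanon x ⊆ {y | f x <+: y}` and
`IsQSolvable.mono` gives `f ∈ FBQP`; (4) length and value clauses are read off the relation. -/
theorem crux_conclusion_of_canonical
    (h : IsQSolvable fun x => {y | ∃ v : List Bool, v.length = 2 * x.length + 8 ∧ v <+: y ∧
      (∀ (K : Type) [Field K] [NumberField K], Module.finrank ℚ K = 3 →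
        (∀ r : ℕ, r ^ 3 ≠ decodeNat x) → (∃ α : K, α ^ 3 = (decodeNat x : K)) →
        v = List.ofFn (fun i : Fin (2 * x.length + 8) => (NumberField.classNumber K).testBit i.val)) ∧
      ((¬ ∃ (K : Type) (_ : Field K) (_ : NumberField K), Module.finrank ℚ K = 3 ∧
          (∀ r : ℕ, r ^ 3 ≠ decodeNat x) ∧ ∃ α : K, α ^ 3 = (decodeNat x : K)) →
        v = List.replicate (2 * x.length + 8) false)}) :
    ∃ f : List Bool → List Bool, f ∈ FBQP ∧ (∀ x, (f x).length = 2 * x.length + 8) ∧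
      ∀ (x : List Bool) (K : Type) [Field K] [NumberField K], Module.finrank ℚ K = 3 →
        (∀ r : ℕ, r ^ 3 ≠ decodeNat x) → (∃ α : K, α ^ 3 = (decodeNat x : K)) →
        f x = List.ofFn (fun i : Fin (2 * x.length + 8) => (NumberField.classNumber K).testBit i.val) := by
  obtain ⟨F, hfree, hU, hF⟩ := h
  -- (1) the relation is nonempty on every input
  have hne : ∀ x : List Bool, ∃ y : List Bool, ∃ v : List Bool, v.length = 2 * x.length + 8 ∧ v <+: y ∧
      (∀ (K : Type) [Field K] [NumberField K], Module.finrank ℚ K = 3 →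
        (∀ r : ℕ, r ^ 3 ≠ decodeNat x) → (∃ α : K, α ^ 3 = (decodeNat x : K)) →
        v = List.ofFn (fun i : Fin (2 * x.length + 8) => (NumberField.classNumber K).testBit i.val)) ∧
      ((¬ ∃ (K : Type) (_ : Field K) (_ : NumberField K), Module.finrank ℚ K = 3 ∧
          (∀ r : ℕ, r ^ 3 ≠ decodeNat x) ∧ ∃ α : K, α ^ 3 = (decodeNat x : K)) →
        v = List.replicate (2 * x.length + 8) false) := by
    intro x
    by_contra hcon
    have hempty : {y : List Bool | ∃ v : List Bool, v.length = 2 * x.length + 8 ∧ v <+: y ∧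
        (∀ (K : Type) [Field K] [NumberField K], Module.finrank ℚ K = 3 →
          (∀ r : ℕ, r ^ 3 ≠ decodeNat x) → (∃ α : K, α ^ 3 = (decodeNat x : K)) →
          v = List.ofFn (fun i : Fin (2 * x.length + 8) => (NumberField.classNumber K).testBit i.val)) ∧
        ((¬ ∃ (K : Type) (_ : Field K) (_ : NumberField K), Module.finrank ℚ K = 3 ∧
            (∀ r : ℕ, r ^ 3 ≠ decodeNat x) ∧ ∃ α : K, α ^ 3 = (decodeNat x : K)) →
          v = List.replicate (2 * x.length + 8) false)} = ∅ :=
      Set.subset_empty_iff.mp fun y hy => (hcon ⟨y, hy⟩).elim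
    have hx : (2 : ℝ) / 3 ≤ F.kernelProb 0 x ∅ := by
      have h0 := hF x
      beta_reduce at h0
      rwa [hempty] at h0
    simp [QCircuitFamily.kernelProb] at hx
    norm_num at hx
  choose y v hlen hpre hall hnone using hne
  -- (3) the word is determined by `x`
  have huniq : ∀ (x : List Bool) (v' : List Bool),
      (∀ (K : Type) [Field K] [NumberField K], Module.finrank ℚ K = 3 →
        (∀ r : ℕ, r ^ 3 ≠ decodeNat x) → (∃ α : K, α ^ 3 = (decodeNat x : K)) →
        v' = List.ofFn (fun i : Fin (2 * x.length + 8) => (NumberField.classNumber K).testBit i.val)) →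
      ((¬ ∃ (K : Type) (_ : Field K) (_ : NumberField K), Module.finrank ℚ K = 3 ∧
          (∀ r : ℕ, r ^ 3 ≠ decodeNat x) ∧ ∃ α : K, α ^ 3 = (decodeNat x : K)) →
        v' = List.replicate (2 * x.length + 8) false) →
      v' = v x := by
    intro x v' hall' hnone'
    by_cases hex : ∃ (K : Type) (_ : Field K) (_ : NumberField K), Module.finrank ℚ K = 3 ∧
        (∀ r : ℕ, r ^ 3 ≠ decodeNat x) ∧ ∃ α : K, α ^ 3 = (decodeNat x : K)
    · obtain ⟨K, iF, iN, hdeg, hnc, hα⟩ := hex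
      rw [hall' K hdeg hnc hα, hall x K hdeg hnc hα]
    · rw [hnone' hex, hnone x hex]
  refine ⟨v, ?_, hlen, ?_⟩
  · -- (2)+(3): `f ∈ FBQP`
    show IsQSolvable fun x => {z | v x <+: z}
    refine isQSolvable_mono ⟨F, hfree, hU, hF⟩ ?_
    intro x z hz
    obtain ⟨v', hlen', hpre', hall', hnone'⟩ := hz
    show v x <+: z
    rw [← huniq x v' hall' hnone']
    exact hpre'
  · -- (4) the value clause
    intro x K _ _ hdeg hnc hα
    exact hall x K hdeg hnc hα

/-- **The skeleton concludes the crux BY NAME**: `LinnikCubicClassGroups.PureCubicClassGroupFBQP`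
(stmt-QuantumAdvantage-11544) from the seven registered stubs. `DegreeOnePrimesEscape` is consumed by S4b only. -/
theorem PureCubicClassGroupFBQP_of : PureCubicClassGroupFBQP := by
  intro hE
  exact crux_conclusion_of_canonical
    (stub_assembly stub_cubicFieldFacts (stub_generation stub_cubicFieldFacts hE)
      (stub_subgroupOrder (stub_regulator stub_packing stub_regulatorPeriod)))

end Summit.QuantumAdvantage.QuantumAdvantage.Cruxes.PureCubicClassGroupFBQP.ArakelovGiantStepCycle
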